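import Summits.MatrixMultiplication.OmegaCensus.SmallFormats.MatMulM22ManyRankOneCount
import HarnessLib

/-!
# ω-census family (a): «short algorithms for `⟨2,2,n⟩` have many RANK-ONE X-forms» — the Lemma-12 count in census coordinates (any field)

Cell `pub-omega` (unit `pub-omega-tensor`, gen 38), topic `Summits/MatrixMultiplication/OmegaCensus` (sub-folder
`SmallFormats`). Framing (verbatim): lottery ticket; floor = certified bounds/negative ranges. HONEST FRAMING: transport of tensor g38's
`Lemma12Gen.fourteen_mul_le_card_rankOne_add` (Alekseev orientation `⟨m,2,2⟩`) to the census orientation `⟨2,2,n⟩` (`XY`, `X ∈ k^{2×2}`,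
X-marginal `U_i` = coefficient matrix of the X-form `f_i`). A structural theorem, NOT a bound on any rank; nothing here is a bound on `ω`.

* `RankOneCensus.exists_trComp₂` — the transposed computation `⟨2,2,n⟩ → ⟨n,2,2⟩` with BOTH of Alekseev's column vectors read off the
  X-marginal: `p_t = row 0 of U_t`, `q_t = row 1 of U_t` (extension of p704972 `FramePlaneCap.exists_trComp`).
* `RankOneCensus.fourteen_mul_le_card_rowProp_add` — **every length-`r` bilinear algorithm for `⟨2,2,n⟩` over any field has at least
  `14n − 4r` X-forms whose coefficient matrix has its second row proportional to its first** (`∃ a, U_i 1 = a • U_i 0`; such a `U_i` has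
  rank `≤ 1`). At `r = 3n + δ`: `≥ 2(n − 2δ)`; e.g. `r = 3n + 2` (the any-field floor): `≥ 2n − 8`.
The sharper per-frame form (`≥ 2(n − δ − e)` for a direction whose frame has `2n + e` members; `≥ 2(n−4)` outside the plane of a loaded
direction at `r = 3n + 3`) is `Lemma12Gen.twelve_mul_le` applied to the computation of `exists_trComp₂`.
-/

namespace Summit.MatrixMultiplication.OmegaCensus.SmallFormats

open Finset Module Matrix
open Literature.Computability.AlgebraicComplexity
open Summit.MatrixMultiplication.OmegaCensus.RankOnePlaneCapGeneral

namespace RankOneCensus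

variable {k : Type*} [Field k] {n : ℕ} {ι : Type*} [Fintype ι]

/-- **The transposed computation** `⟨2,2,n⟩ → ⟨n,2,2⟩` (`x y = (yᵀ xᵀ)ᵀ`) with Alekseev's `p_t`, `q_t` = rows `0`, `1` of the X-marginal. -/
theorem exists_trComp₂ (β : BilinComp (mulBilin k 2 2 n) ι) :
    ∃ β' : BilinComp (mulBilin k n 2 2) ι,
      (∀ t j, Alekseev2015.pvec β' t j = xMarginal β t 0 j) ∧ (∀ t j, Alekseev2015.qvec β' t j = xMarginal β t 1 j) := by
  refine ⟨{ f := fun t => (β.g t) ∘ₗ (Matrix.transposeLinearEquiv (Fin n) (Fin 2) k k).toLinearMap,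
            g := fun t => (β.f t) ∘ₗ (Matrix.transposeLinearEquiv (Fin 2) (Fin 2) k k).toLinearMap,
            w := fun t => (β.w t)ᵀ,
            map_eq_sum := fun x y => ?_ }, fun t j => ?_, fun t j => ?_⟩
  · have h := β.map_eq_sum yᵀ xᵀ
    rw [mulBilin_apply] at h
    rw [mulBilin_apply, ← Matrix.transpose_transpose (x * y), Matrix.transpose_mul, h, Matrix.transpose_sum]
    refine Finset.sum_congr rfl fun t _ => ?_
    rw [Matrix.transpose_smul, mul_comm]
    rfl
  · show β.f t (Matrix.single j 0 (1 : k))ᵀ = xMarginal β t 0 j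
    rw [Matrix.transpose_single, xMarginal_apply]
  · show β.f t (Matrix.single j 1 (1 : k))ᵀ = xMarginal β t 1 j
    rw [Matrix.transpose_single, xMarginal_apply]

open scoped Classical in
/-- **Every length-`r` algorithm for `⟨2,2,n⟩` (any field) has at least `14n − 4r` X-forms `f_i` whose coefficient matrix `U_i` has
proportional rows** (`row 1 = a · row 0`; in particular `rank U_i ≤ 1`): `14n ≤ #{i : ∃ a, U_i 1 = a • U_i 0} + 4r`. -/
theorem fourteen_mul_le_card_rowProp_add (β : BilinComp (mulBilin k 2 2 n) ι) :
    14 * n ≤ (Finset.univ.filter fun i => ∃ a : k, (fun j => xMarginal β i 1 j) = a • (fun j => xMarginal β i 0 j)).card +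
      4 * Fintype.card ι := by
  classical
  obtain ⟨β', hp, hq⟩ := exists_trComp₂ β
  have h := Lemma12Gen.fourteen_mul_le_card_rankOne_add β'
  have hsub : (Finset.univ.filter fun t => ∃ a : k, Alekseev2015.qvec β' t = a • Alekseev2015.pvec β' t) ⊆
      (Finset.univ.filter fun i => ∃ a : k, (fun j => xMarginal β i 1 j) = a • (fun j => xMarginal β i 0 j)) := by
    intro t ht
    rw [Finset.mem_filter] at ht ⊢
    obtain ⟨a, ha⟩ := ht.2
    refine ⟨Finset.mem_univ _, a, ?_⟩
    funext j
    have := congrFun ha j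
    rw [hq, Pi.smul_apply, hp] at this
    rw [this, Pi.smul_apply]
  have hcard := Finset.card_le_card hsub
  omega

end RankOneCensus

end Summit.MatrixMultiplication.OmegaCensus.SmallFormats
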